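import Literature.MathematicalPhysics.QuantumLattice.HubbardTTPrimeTwoColumnCapTransport
import HarnessLib

/-!
# `K₂` words from energy rows: the secant bounds on the diagonal-hopping energy of a torus-limit
# ground state, in the word shape consumed by the `t'`-transport theorems

Family `hubbard` (topic `MathematicalPhysics/QuantumLattice`); written for stage S2
"certifier-families" of the Hubbard material-oracle programme, seat `hubbard-box-p3`; companion of
`HubbardTTPrimeHoppingSupergradient` (§2 there: the FINITE-torus secants `diagHop_le_of_bounds`,
`le_diagHop_of_bounds`), `HubbardTTPrimeDiagHopTransport`, `HubbardTTPrimeTwoColumnCaps` and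
`HubbardTTPrimeTwoColumnCapTransport` (which consume `K₂` WORDS: `K₂(ω) ≤ A` / `B ≤ K₂(ω)` for every
torus-limit ground state `ω` at a column). Notation as there: `e(t,t',U,n) = energyDensityTT' t t' U n`;
`K₂(ω) = ω.meanEnergy (hubbardTTPrimeFermionInteraction 0 1 0) 1` (`= -HOP2`).

THE POINT. The Hellmann–Feynman tangent inequality in the thermodynamic limit
(`IsTorusLimitOf.energyDensityTT'_sub_le_mul_meanEnergy_diag`: `e(t,s',U,n) − e(t,s,U,n) ≤ (s' − s)K₂(ω)`
for a torus-limit ground state `ω` at `(t,s,U)`) makes every pair of certified ENERGY rows at two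
values of `t'` a `K₂` word at one of them: a cap `R` at `s` and a floor `L₀` at `s₀ < s` give the
CEILING word `K₂(ω) ≤ (R − L₀)/(s − s₀)`; a cap `R` at `s` and a floor `L₃` at `s₃ > s` give the FLOOR
word `(L₃ − R)/(s₃ − s) ≤ K₂(ω)` (§1, and the `∀`-packaged forms of §2, literally the hypotheses `hA`,
`hB` of the transport files). These are the registry's "derived `K₂` rows" as theorems: at
`(U, n) = (8, 7/8)` the cap `#445` at `t' = -1/4` with the floor `#473` at `t' = 0` is the floor word
`K₂ ≥ (−0.83723 + 0.68664)/0.25 = −0.6024` at `-1/4`, and the cap `#354` at `0` with the floor `#448`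
at `-1/4` is the ceiling word `K₂ ≤ 0.5653` at `0` — the two one-sided registry rows A0/A0′, and to
four digits the b2-class SDP `hop2` edges there. §3 plugs the secant words into the far-column
cap-class transport of `HubbardTTPrimeTwoColumnCapTransport`: three energy rows book a certificate
across a cell (`IsTorusLimitOf.meanEnergy_anchor_le_of_leftColumn_secant`, `…_of_rightColumn_secant`,
BOX ⇒ WORD forms); the energy-cap twin is `HubbardTTPrimeTwoColumnCaps` §3 (`…_of_outerFloors`).

HONEST FRAMING: bookkeeping of concavity / the tangent inequality for the systematic → certified
interface; no number is produced here (the decimals above are an illustration on rows of record, not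
derived rows); nothing here bears on superconductivity by itself. Everything is PROVED; no
definition, no named fact, no numerical input.

## Mathlib / tree search

REUSED: `IsTorusLimitOf.energyDensityTT'_sub_le_mul_meanEnergy_diag` (`HubbardTTPrimeMeanEnergySupergradient`
§3), `IsTorusLimitOf.meanEnergy_anchor_le_of_leftColumn/_of_rightColumn` (`HubbardTTPrimeTwoColumnCapTransport`
§1), `mem_szSector_iff`. `lean search 'diagHop_le_secant|secant_le_meanEnergy_diagHop|diagHop.*of_bounds'`:
finite-torus forms only (`HubbardTTPrimeHoppingSupergradient.diagHop_le_of_bounds`, `le_diagHop_of_bounds`);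
no thermodynamic-limit word form.

## References

* T. Koma, H. Tasaki, J. Stat. Phys. 76 (1994) 745, §1 (the conjugate observable lies between the
  one-sided derivatives of the concave ground-state energy; secants bound derivatives).
  [cite: KomaTasaki1994, §1]
* R. B. Griffiths, Phys. Rev. 152 (1966) 240, §II. [cite: Griffiths1966, §II]
* D. Ruelle, *Statistical Mechanics: Rigorous Results* (1969), §3.3 (concavity in the couplings).
  [cite: Ruelle1969, §3.3]
-/

noncomputable section

namespace Literature.MathematicalPhysics.QuantumLattice

open Matrix Finset HubbardWave0 Literature.Probability.LatticeModels ThermodynamicLimit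
open _root_.Filter
open scoped _root_.Topology ComplexOrder BigOperators

namespace InfVolFermionState

/-! ### §1 Secant words for one torus-limit ground state -/

/-- **Ceiling word from a floor on the LEFT.** For `s₀ < s` (same `t`, `U ≥ 0`, density `0 ≤ n < 2`),
a floor `L₀ ≤ e(t,s₀,U,n)` and a cap `e(t,s,U,n) ≤ R`: every torus-limit ground state `ω` at `(t,s,U)`
has `K₂(ω) ≤ (R − L₀)/(s − s₀)` (the tangent at `s` lies above the concave `e`, so its slope `K₂(ω)`
is at most the secant slope to any point on the left). [cite: KomaTasaki1994, §1] [cite: Ruelle1969, §3.3] -/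
theorem IsTorusLimitOf.meanEnergy_diagHop_le_secant (t : ℝ) {s₀ s : ℝ} (hs : s₀ < s) {U : ℝ}
    (hU : 0 ≤ U) {n : ℝ} (hn0 : 0 ≤ n) (hn2 : n < 2) {L₀ R : ℝ}
    (hL₀ : L₀ ≤ energyDensityTT' t s₀ U n) (hR : energyDensityTT' t s U n ≤ R)
    {ω : InfVolFermionState 2} {ψ : ∀ L, Fock (Orb (FermionTorus 2 L))} {Ls : ℕ → ℕ}
    (h : ω.IsTorusLimitOf ψ Ls) (hLs : Tendsto Ls atTop atTop)
    (hψ : ∀ j, IsGroundStateInSector (hubbardTorusTT' (Ls j) t s U) (rectN n (Ls j)) 0 (ψ (Ls j)))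
    (h1 : ∀ j, star (ψ (Ls j)) ⬝ᵥ ψ (Ls j) = 1) :
    ω.meanEnergy (hubbardTTPrimeFermionInteraction 0 1 0) 1 ≤ (R - L₀) / (s - s₀) := by
  have htan := h.energyDensityTT'_sub_le_mul_meanEnergy_diag t s hU hn0 hn2 hLs hψ h1 s₀
  rw [le_div_iff₀ (sub_pos.2 hs)]
  have e : ω.meanEnergy (hubbardTTPrimeFermionInteraction 0 1 0) 1 * (s - s₀) =
      -((s₀ - s) * ω.meanEnergy (hubbardTTPrimeFermionInteraction 0 1 0) 1) := by ring
  rw [e]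
  linarith

/-- **Floor word from a floor on the RIGHT.** For `s < s₃`, a cap `e(t,s,U,n) ≤ R` and a floor
`L₃ ≤ e(t,s₃,U,n)`: every torus-limit ground state `ω` at `(t,s,U)` has `(L₃ − R)/(s₃ − s) ≤ K₂(ω)`.
[cite: KomaTasaki1994, §1] [cite: Ruelle1969, §3.3] -/
theorem IsTorusLimitOf.secant_le_meanEnergy_diagHop (t : ℝ) {s s₃ : ℝ} (hs : s < s₃) {U : ℝ}
    (hU : 0 ≤ U) {n : ℝ} (hn0 : 0 ≤ n) (hn2 : n < 2) {R L₃ : ℝ}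
    (hR : energyDensityTT' t s U n ≤ R) (hL₃ : L₃ ≤ energyDensityTT' t s₃ U n)
    {ω : InfVolFermionState 2} {ψ : ∀ L, Fock (Orb (FermionTorus 2 L))} {Ls : ℕ → ℕ}
    (h : ω.IsTorusLimitOf ψ Ls) (hLs : Tendsto Ls atTop atTop)
    (hψ : ∀ j, IsGroundStateInSector (hubbardTorusTT' (Ls j) t s U) (rectN n (Ls j)) 0 (ψ (Ls j)))
    (h1 : ∀ j, star (ψ (Ls j)) ⬝ᵥ ψ (Ls j) = 1) :
    (L₃ - R) / (s₃ - s) ≤ ω.meanEnergy (hubbardTTPrimeFermionInteraction 0 1 0) 1 := by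
  have htan := h.energyDensityTT'_sub_le_mul_meanEnergy_diag t s hU hn0 hn2 hLs hψ h1 s₃
  rw [div_le_iff₀ (sub_pos.2 hs)]
  have e : ω.meanEnergy (hubbardTTPrimeFermionInteraction 0 1 0) 1 * (s₃ - s) =
      (s₃ - s) * ω.meanEnergy (hubbardTTPrimeFermionInteraction 0 1 0) 1 := by ring
  rw [e]
  linarith

/-- **Two-sided secant window.** For `s₀ < s < s₃`, floors `L₀` at `s₀`, `L₃` at `s₃` and a cap `R` at
`s`: `K₂(ω) ∈ [(L₃ − R)/(s₃ − s), (R − L₀)/(s − s₀)]` for every torus-limit ground state `ω` at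
`(t,s,U)`. [cite: KomaTasaki1994, §1] [cite: Ruelle1969, §3.3] -/
theorem IsTorusLimitOf.meanEnergy_diagHop_mem_Icc_secants (t : ℝ) {s₀ s s₃ : ℝ} (h₀ : s₀ < s)
    (h₃ : s < s₃) {U : ℝ} (hU : 0 ≤ U) {n : ℝ} (hn0 : 0 ≤ n) (hn2 : n < 2) {L₀ R L₃ : ℝ}
    (hL₀ : L₀ ≤ energyDensityTT' t s₀ U n) (hR : energyDensityTT' t s U n ≤ R)
    (hL₃ : L₃ ≤ energyDensityTT' t s₃ U n)
    {ω : InfVolFermionState 2} {ψ : ∀ L, Fock (Orb (FermionTorus 2 L))} {Ls : ℕ → ℕ}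
    (h : ω.IsTorusLimitOf ψ Ls) (hLs : Tendsto Ls atTop atTop)
    (hψ : ∀ j, IsGroundStateInSector (hubbardTorusTT' (Ls j) t s U) (rectN n (Ls j)) 0 (ψ (Ls j)))
    (h1 : ∀ j, star (ψ (Ls j)) ⬝ᵥ ψ (Ls j) = 1) :
    ω.meanEnergy (hubbardTTPrimeFermionInteraction 0 1 0) 1 ∈
      Set.Icc ((L₃ - R) / (s₃ - s)) ((R - L₀) / (s - s₀)) :=
  ⟨h.secant_le_meanEnergy_diagHop t h₃ hU hn0 hn2 hR hL₃ hLs hψ h1,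
    h.meanEnergy_diagHop_le_secant t h₀ hU hn0 hn2 hL₀ hR hLs hψ h1⟩

/-! ### §2 The packaged words (the hypothesis shapes `hA`, `hB` of the transport files) -/

/-- **The secant CEILING word at a column**, packaged: a floor `L₀` at `s₀ < s` and a cap `R` at `s`
give the word "`K₂ ≤ (R − L₀)/(s − s₀)` for every torus-limit ground state at `(t,s,U)`, density `n`"
— literally the hypothesis `hA` of `energyDensityTT'_sub_le_mul_of_forall_diagHop_le`,
`energyDensityTT'_tPrime_interval_le_of_columnWords`, `IsTorusLimitOf.meanEnergy_anchor_le_of_leftColumn`, … .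
[cite: KomaTasaki1994, §1] -/
theorem forall_isTorusLimitOf_meanEnergy_diagHop_le_secant (t : ℝ) {s₀ s : ℝ} (hs : s₀ < s) {U : ℝ}
    (hU : 0 ≤ U) {n : ℝ} (hn0 : 0 ≤ n) (hn2 : n < 2) {L₀ R : ℝ}
    (hL₀ : L₀ ≤ energyDensityTT' t s₀ U n) (hR : energyDensityTT' t s U n ≤ R) :
    ∀ (ω : InfVolFermionState 2) (Ls : ℕ → ℕ) (ψ : ∀ L, Fock (Orb (FermionTorus 2 L))),
      Tendsto Ls atTop atTop →
      (∀ j, IsGroundStateInSector (hubbardTorusTT' (Ls j) t s U) (rectN n (Ls j)) 0 (ψ (Ls j))) →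
      (∀ j, star (ψ (Ls j)) ⬝ᵥ ψ (Ls j) = 1) → ω.IsTorusLimitOf ψ Ls →
      ω.meanEnergy (hubbardTTPrimeFermionInteraction 0 1 0) 1 ≤ (R - L₀) / (s - s₀) :=
  fun _ω _Ls _ψ hLs hψ h1 hω => hω.meanEnergy_diagHop_le_secant t hs hU hn0 hn2 hL₀ hR hLs hψ h1

/-- **The secant FLOOR word at a column**, packaged: a cap `R` at `s` and a floor `L₃` at `s₃ > s`
give the word "`(L₃ − R)/(s₃ − s) ≤ K₂` for every torus-limit ground state at `(t,s,U)`, density `n`"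
— the hypothesis `hB` of `mul_le_energyDensityTT'_sub_of_forall_le_diagHop`,
`IsTorusLimitOf.meanEnergy_anchor_le_of_rightColumn`, … . [cite: KomaTasaki1994, §1] -/
theorem forall_isTorusLimitOf_secant_le_meanEnergy_diagHop (t : ℝ) {s s₃ : ℝ} (hs : s < s₃) {U : ℝ}
    (hU : 0 ≤ U) {n : ℝ} (hn0 : 0 ≤ n) (hn2 : n < 2) {R L₃ : ℝ}
    (hR : energyDensityTT' t s U n ≤ R) (hL₃ : L₃ ≤ energyDensityTT' t s₃ U n) :
    ∀ (ω : InfVolFermionState 2) (Ls : ℕ → ℕ) (ψ : ∀ L, Fock (Orb (FermionTorus 2 L))),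
      Tendsto Ls atTop atTop →
      (∀ j, IsGroundStateInSector (hubbardTorusTT' (Ls j) t s U) (rectN n (Ls j)) 0 (ψ (Ls j))) →
      (∀ j, star (ψ (Ls j)) ⬝ᵥ ψ (Ls j) = 1) → ω.IsTorusLimitOf ψ Ls →
      (L₃ - R) / (s₃ - s) ≤ ω.meanEnergy (hubbardTTPrimeFermionInteraction 0 1 0) 1 :=
  fun _ω _Ls _ψ hLs hψ h1 hω => hω.secant_le_meanEnergy_diagHop t hs hU hn0 hn2 hR hL₃ hLs hψ h1

/-! ### §3 Cap-class certificate transport booked with three energy rows -/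

/-- **Anchor energy from the LEFT column, secant-priced.** For `s' < s₁ ≤ s ≤ s₀`: a floor `L` at the
outer point `s'`, a cap `R₁` at the column `s₁`; every torus-limit ground state `ω` at `(t,s,U)` has
`e_{Φ(t,s₀,U)}(ω) ≤ R₁ + (s₀ − s₁)·(R₁ − L)/(s₁ − s')` (`IsTorusLimitOf.meanEnergy_anchor_le_of_leftColumn`
with the secant ceiling word at `s₁`). [cite: KomaTasaki1994, §1] [cite: WangEtAl2024, §III] -/
theorem IsTorusLimitOf.meanEnergy_anchor_le_of_leftColumn_secant (t : ℝ) {s' s₁ s s₀ : ℝ}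
    (hs' : s' < s₁) (hs₁ : s₁ ≤ s) (hs₀ : s ≤ s₀) {U : ℝ} (hU : 0 ≤ U) {n : ℝ} (hn0 : 0 ≤ n)
    (hn2 : n < 2) {L R₁ : ℝ} (hL : L ≤ energyDensityTT' t s' U n) (hR₁ : energyDensityTT' t s₁ U n ≤ R₁)
    {ω : InfVolFermionState 2} {ψ : ∀ L, Fock (Orb (FermionTorus 2 L))} {Ls : ℕ → ℕ}
    (h : ω.IsTorusLimitOf ψ Ls) (hLs : Tendsto Ls atTop atTop)
    (hψ : ∀ j, IsGroundStateInSector (hubbardTorusTT' (Ls j) t s U) (rectN n (Ls j)) 0 (ψ (Ls j)))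
    (h1 : ∀ j, star (ψ (Ls j)) ⬝ᵥ ψ (Ls j) = 1) :
    ω.meanEnergy (hubbardTTPrimeFermionInteraction t s₀ U) 1 ≤ R₁ + (s₀ - s₁) * ((R₁ - L) / (s₁ - s')) :=
  h.meanEnergy_anchor_le_of_leftColumn t hs₁ hs₀ hU hn0 hn2 hR₁
    (forall_isTorusLimitOf_meanEnergy_diagHop_le_secant t hs' hU hn0 hn2 hL hR₁) hLs hψ h1

/-- **Anchor energy from the RIGHT column, secant-priced.** For `s₀ ≤ s ≤ s₂ < s'`: a cap `R₂` at the
column `s₂`, a floor `L` at the outer point `s'`; every torus-limit ground state `ω` at `(t,s,U)` has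
`e_{Φ(t,s₀,U)}(ω) ≤ R₂ + (s₂ − s₀)·(R₂ − L)/(s' − s₂)`. [cite: KomaTasaki1994, §1] [cite: WangEtAl2024, §III] -/
theorem IsTorusLimitOf.meanEnergy_anchor_le_of_rightColumn_secant (t : ℝ) {s₀ s s₂ s' : ℝ}
    (hs₀ : s₀ ≤ s) (hs₂ : s ≤ s₂) (hs' : s₂ < s') {U : ℝ} (hU : 0 ≤ U) {n : ℝ} (hn0 : 0 ≤ n)
    (hn2 : n < 2) {R₂ L : ℝ} (hR₂ : energyDensityTT' t s₂ U n ≤ R₂) (hL : L ≤ energyDensityTT' t s' U n)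
    {ω : InfVolFermionState 2} {ψ : ∀ L, Fock (Orb (FermionTorus 2 L))} {Ls : ℕ → ℕ}
    (h : ω.IsTorusLimitOf ψ Ls) (hLs : Tendsto Ls atTop atTop)
    (hψ : ∀ j, IsGroundStateInSector (hubbardTorusTT' (Ls j) t s U) (rectN n (Ls j)) 0 (ψ (Ls j)))
    (h1 : ∀ j, star (ψ (Ls j)) ⬝ᵥ ψ (Ls j) = 1) :
    ω.meanEnergy (hubbardTTPrimeFermionInteraction t s₀ U) 1 ≤ R₂ + (s₂ - s₀) * ((R₂ - L) / (s' - s₂)) := by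
  have hmain := h.meanEnergy_anchor_le_of_rightColumn t hs₀ hs₂ hU hn0 hn2 hR₂
    (forall_isTorusLimitOf_secant_le_meanEnergy_diagHop t hs' hU hn0 hn2 hR₂ hL) hLs hψ h1
  have e : R₂ - (s₂ - s₀) * ((L - R₂) / (s' - s₂)) = R₂ + (s₂ - s₀) * ((R₂ - L) / (s' - s₂)) := by
    rw [← neg_sub R₂ L, neg_div]
    ring
  rwa [e] at hmain

/-- **BOX ⇒ WORD left of the anchor, three energy rows.** Floor `L` at `s' < s₁`, cap `R₁` at `s₁`;
a cap-class property `P` certified at the anchor `s₀ ≥ s₁` for the cap `u` holds for every torus-limit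
ground state at every `t' ∈ [s₁, s₀]` as soon as `R₁ + (s₀ − s₁)(R₁ − L)/(s₁ − s') ≤ u`.
[cite: WangEtAl2024, §III] [cite: KomaTasaki1994, §1] -/
theorem forall_groundState_tPrime_cell_of_forall_cap_leftColumn_secant (t : ℝ) {s' s₁ s₀ : ℝ}
    (hs' : s' < s₁) {U : ℝ} (hU : 0 ≤ U) {n : ℝ} (hn0 : 0 ≤ n) (hn2 : n < 2) {L R₁ u : ℝ}
    (hL : L ≤ energyDensityTT' t s' U n) (hR₁ : energyDensityTT' t s₁ U n ≤ R₁)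
    (hu : R₁ + (s₀ - s₁) * ((R₁ - L) / (s₁ - s')) ≤ u)
    {P : InfVolFermionState 2 → Prop}
    (hP : ∀ (ω : InfVolFermionState 2) (Ls : ℕ → ℕ) (ψ : ∀ L, Fock (Orb (FermionTorus 2 L))),
      Tendsto Ls atTop atTop → (∀ j, IsNParticle (rectN n (Ls j)) (ψ (Ls j))) →
      (∀ j, star (ψ (Ls j)) ⬝ᵥ ψ (Ls j) = 1) → ω.IsTorusLimitOf ψ Ls →
      ω.meanEnergy (hubbardTTPrimeFermionInteraction t s₀ U) 1 ≤ u → P ω)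
    {s : ℝ} (hs : s ∈ Set.Icc s₁ s₀)
    {ω : InfVolFermionState 2} {ψ : ∀ L, Fock (Orb (FermionTorus 2 L))} {Ls : ℕ → ℕ}
    (h : ω.IsTorusLimitOf ψ Ls) (hLs : Tendsto Ls atTop atTop)
    (hψ : ∀ j, IsGroundStateInSector (hubbardTorusTT' (Ls j) t s U) (rectN n (Ls j)) 0 (ψ (Ls j)))
    (h1 : ∀ j, star (ψ (Ls j)) ⬝ᵥ ψ (Ls j) = 1) : P ω :=
  forall_groundState_tPrime_cell_of_forall_cap_leftColumn t hU hn0 hn2 hR₁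
    (forall_isTorusLimitOf_meanEnergy_diagHop_le_secant t hs' hU hn0 hn2 hL hR₁) hu hP hs h hLs hψ h1

/-- **BOX ⇒ WORD right of the anchor, three energy rows.** Cap `R₂` at `s₂`, floor `L` at `s' > s₂`;
a cap-class property `P` certified at the anchor `s₀ ≤ s₂` for the cap `u` holds for every torus-limit
ground state at every `t' ∈ [s₀, s₂]` as soon as `R₂ + (s₂ − s₀)(R₂ − L)/(s' − s₂) ≤ u`.
[cite: WangEtAl2024, §III] [cite: KomaTasaki1994, §1] -/
theorem forall_groundState_tPrime_cell_of_forall_cap_rightColumn_secant (t : ℝ) {s₀ s₂ s' : ℝ}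
    (hs' : s₂ < s') {U : ℝ} (hU : 0 ≤ U) {n : ℝ} (hn0 : 0 ≤ n) (hn2 : n < 2) {R₂ L u : ℝ}
    (hR₂ : energyDensityTT' t s₂ U n ≤ R₂) (hL : L ≤ energyDensityTT' t s' U n)
    (hu : R₂ + (s₂ - s₀) * ((R₂ - L) / (s' - s₂)) ≤ u)
    {P : InfVolFermionState 2 → Prop}
    (hP : ∀ (ω : InfVolFermionState 2) (Ls : ℕ → ℕ) (ψ : ∀ L, Fock (Orb (FermionTorus 2 L))),
      Tendsto Ls atTop atTop → (∀ j, IsNParticle (rectN n (Ls j)) (ψ (Ls j))) →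
      (∀ j, star (ψ (Ls j)) ⬝ᵥ ψ (Ls j) = 1) → ω.IsTorusLimitOf ψ Ls →
      ω.meanEnergy (hubbardTTPrimeFermionInteraction t s₀ U) 1 ≤ u → P ω)
    {s : ℝ} (hs : s ∈ Set.Icc s₀ s₂)
    {ω : InfVolFermionState 2} {ψ : ∀ L, Fock (Orb (FermionTorus 2 L))} {Ls : ℕ → ℕ}
    (h : ω.IsTorusLimitOf ψ Ls) (hLs : Tendsto Ls atTop atTop)
    (hψ : ∀ j, IsGroundStateInSector (hubbardTorusTT' (Ls j) t s U) (rectN n (Ls j)) 0 (ψ (Ls j)))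
    (h1 : ∀ j, star (ψ (Ls j)) ⬝ᵥ ψ (Ls j) = 1) : P ω := by
  have hN : ∀ j, IsNParticle (rectN n (Ls j)) (ψ (Ls j)) := fun j =>
    ((mem_szSector_iff _ _ _).1 (hψ j).1).1
  exact hP ω Ls ψ hLs hN h1 h
    ((h.meanEnergy_anchor_le_of_rightColumn_secant t hs.1 hs.2 hs' hU hn0 hn2 hR₂ hL hLs hψ h1).trans
      hu)

end InfVolFermionState

end Literature.MathematicalPhysics.QuantumLattice

end
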